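import Literature.Analysis.Complex.KoebeDistortion
import Literature.Analysis.Complex.KoebeQuarterProofs
import Mathlib.Analysis.Complex.Schwarz
import HarnessLib

/-!
# Conformal-interior points: distance to the boundary and short chains from the base point (Koebe)

Topic `Literature/Analysis/Complex` (conformal maps; companion of `KoebeDistortion.lean`,
`KoebeQuarterProofs.lean`). Let `F` be a conformal map of the unit disc `𝔻` (holomorphic and
injective) onto `D = F(𝔻)`, with base point `z₀ = F 0`, and suppose `B(z₀, ρ₀) ⊆ D` (inner radius
`≥ ρ₀`) and some `b ∉ D` has `‖b - z₀‖ ≤ ρ₁`. The classical consequences of the Koebe distortion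
theorem which Lawler–Schramm–Werner use throughout §5 of *Conformal invariance of planar
loop-erased random walks and uniform spanning trees*, Ann. Probab. 32 (2004) (arXiv
math/0112234, p. 27: "First, note that `1/4 ≤ inrad(D) ψ_D'(0) ≤ 1` follows from the Koebe 1/4
Theorem and the Schwarz Lemma, respectively. Let `ℓ = ℓ(ε)` be large, set `z_j := j ψ_D(v)/ℓ`,
and `w_j := ψ_D⁻¹(z_j)`, `j = 0, 1, …, ℓ`. The Koebe distortion theorem gives upper and lower
bounds for `inrad(D) |ψ_D'|` on the preimage of the line segment `[0, z_ℓ]`. This implies that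
there is a constant `c₁ = c₁(ε) > 0` such that `dist(w_j, ∂D) ≥ c₁ inrad(D)`, and that if
`ℓ = ℓ(ε)` is large then `|w_j - w_{j-1}| ≤ c₁ inrad(D)/20`"), with explicit constants, for points
`ζ` of the closed disc `|ζ| ≤ r < 1` (`ψ_D = F⁻¹`):

* `le_norm_deriv_zero` — **Schwarz**: `ρ₀ ≤ |F'(0)|` (and Koebe: `|F'(0)| ≤ 4 ρ₁`,
  `norm_deriv_zero_le`);
* `ball_subset_image_affine` — Koebe's one-quarter theorem about `ζ` at scale `s ≤ 1 - r`:
  `B(F ζ, s ρ₀ (1-r)/32) ⊆ F(B(ζ, s))`; hence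
  `ball_subset_image_of_norm_le` — **distance to the boundary**: `B(F ζ, ρ₀ (1-r)²/32) ⊆ D`, and
  `exists_apply_eq_of_norm_sub_lt` — **conformal coordinates of nearby points are nearby**: a
  point within `ε ρ₀ (1-r)/32` of `F ζ` is `F ζ'` with `|ζ' - ζ| < ε` (lattice points are dense
  in conformal coordinates when the inner radius is large);
* `norm_sub_le_of_norm_le` — **steps**: `‖F ζ - F ζ'‖ ≤ 8 ρ₁ (1-r)⁻³ ‖ζ - ζ'‖` on `|ζ|, |ζ'| ≤ r`;
* `norm_sub_apply_zero_le` — **position**: `‖F ζ - z₀‖ ≤ 4 ρ₁ r/(1-r)²`;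
* `chain` — the points `w_j = F((j/N) ζ)`, `j = 0, …, N`, run from `z₀` to `F ζ`, each with
  `B(w_j, ρ₀(1-r)²/32) ⊆ D`, consecutive ones at distance `≤ 8 ρ₁ r (1-r)⁻³ / N`.

Everything is proved from the tree's `AreaThm.distortion_le_norm_deriv`,
`AreaThm.norm_deriv_le_distortion`, `AreaThm.norm_sub_le_growth`, `koebeQuarter_holds` and
`Complex.hasStrictDerivAt_invFunOn`.

## References

* G. F. Lawler, O. Schramm, W. Werner, Ann. Probab. 32 (2004), §5.1, proof of Lemma 5.2
  (arXiv p. 27). [LawlerSchrammWerner2004]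
* Ch. Pommerenke, *Boundary Behaviour of Conformal Maps* (1992), Thm. 1.3, Cor. 1.4.
  [PommerenkeBBCM1992]
-/

noncomputable section

open Set Filter Metric Real Function
open _root_.Complex _root_.Topology

namespace Literature.Analysis.Complex

namespace KoebeInterior

variable {F : ℂ → ℂ} (hF : DifferentiableOn ℂ F (ball 0 1)) (hinj : InjOn F (ball 0 1))
include hF hinj

/-- The derivative of a univalent map of the disc does not vanish. [folklore] -/
theorem deriv_ne_zero {z : ℂ} (hz : z ∈ ball (0 : ℂ) 1) : deriv F z ≠ 0 :=
  SCV.deriv_ne_zero_of_injOn hF isOpen_ball hinj hz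

/-- **Schwarz: the inner radius bounds `|F'(0)|` from below.** If `B(F 0, ρ₀) ⊆ F(𝔻)` then
`ρ₀ ≤ |F'(0)|` (apply the Schwarz lemma to the holomorphic inverse on that disc). LSW (2004),
§5.1: "`inrad(D) ψ_D'(0) ≤ 1` follows from the Schwarz Lemma". [cite: LawlerSchrammWerner2004, §5.1 (proof of Lemma 5.2)] -/
theorem le_norm_deriv_zero {ρ₀ : ℝ} (hρ₀ : 0 < ρ₀) (hsub : ball (F 0) ρ₀ ⊆ F '' ball 0 1) :
    ρ₀ ≤ ‖deriv F 0‖ := by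
  have hne : ∀ z ∈ ball (0 : ℂ) 1, deriv F z ≠ 0 := fun z hz ↦ deriv_ne_zero hF hinj hz
  have h0 : (0 : ℂ) ∈ ball (0 : ℂ) 1 := mem_ball_self one_pos
  set G : ℂ → ℂ := invFunOn F (ball 0 1) with hG
  have hGd : DifferentiableOn ℂ G (F '' ball 0 1) :=
    Complex.differentiableOn_invFunOn_image isOpen_ball hF hinj hne
  have hG0 : G (F 0) = 0 := hinj.leftInvOn_invFunOn h0
  have hmaps : MapsTo G (ball (F 0) ρ₀) (closedBall (G (F 0)) 1) := fun w hw ↦ by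
    obtain ⟨z, hz, rfl⟩ := hsub hw
    rw [hG0, show G (F z) = z from hinj.leftInvOn_invFunOn hz]
    exact ball_subset_closedBall hz
  have hS := Complex.norm_deriv_le_div_of_mapsTo_ball (hGd.mono hsub) hmaps hρ₀
  have hder : deriv G (F 0) = (deriv F 0)⁻¹ :=
    (Complex.hasStrictDerivAt_invFunOn isOpen_ball hF hinj hne h0).hasDerivAt.deriv
  rw [hder, norm_inv] at hS
  have hpos : 0 < ‖deriv F 0‖ := norm_pos_iff.2 (hne 0 h0)
  rw [inv_le_comm₀ hpos (by positivity), one_div, inv_inv] at hS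
  exact hS

omit hF hinj in
/-- **Koebe: an omitted value bounds `|F'(0)|` from above**: if `b ∉ F(𝔻)` and `‖b - F 0‖ ≤ ρ₁`
then `|F'(0)| ≤ 4 ρ₁` (one-quarter theorem). LSW (2004), §5.1: "`1/4 ≤ inrad(D) ψ_D'(0)`
follows from the Koebe 1/4 Theorem". [cite: LawlerSchrammWerner2004, §5.1 (proof of Lemma 5.2)] -/
theorem norm_deriv_zero_le (hF : DifferentiableOn ℂ F (ball 0 1)) (hinj : InjOn F (ball 0 1))
    {ρ₁ : ℝ} {b : ℂ} (hb : b ∉ F '' ball 0 1) (hbρ : ‖b - F 0‖ ≤ ρ₁) :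
    ‖deriv F 0‖ ≤ 4 * ρ₁ := by
  by_contra hlt
  push Not at hlt
  have hmem : b ∈ ball (F 0) (‖deriv F 0‖ / 4) := by
    rw [mem_ball, dist_eq_norm]; linarith
  exact hb (koebeQuarter_holds F hF hinj hmem)

/-- **Koebe's one-quarter theorem about a conformal-interior point, rescaled**: if
`B(F 0, ρ₀) ⊆ F(𝔻)`, `|ζ| ≤ r < 1` and `0 < s ≤ 1 - r`, then every point within
`s ρ₀ (1-r)/32` of `F ζ` is of the form `F(ζ + s η)` with `|η| < 1` (one-quarter theorem for
`η ↦ F(ζ + s η)`, distortion lower bound `|F'(ζ)| ≥ |F'(0)| (1-r)/(1+r)³ ≥ ρ₀ (1-r)/8`).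
[cite: PommerenkeBBCM1992, Thm. 1.3, Cor. 1.4] -/
theorem ball_subset_image_affine {ρ₀ : ℝ} (hρ₀ : 0 < ρ₀)
    (hsub : ball (F 0) ρ₀ ⊆ F '' ball 0 1) {ζ : ℂ} {r : ℝ} (hζ : ‖ζ‖ ≤ r) (hr : r < 1)
    {s : ℝ} (hs0 : 0 < s) (hs1 : s ≤ 1 - r) :
    ball (F ζ) (s * ρ₀ * (1 - r) / 32) ⊆ (fun η : ℂ ↦ F (ζ + s * η)) '' ball 0 1 := by
  have hζ1 : ‖ζ‖ < 1 := hζ.trans_lt hr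
  set Φ : ℂ → ℂ := fun η ↦ F (ζ + s * η) with hΦ
  have hA : ∀ η ∈ ball (0 : ℂ) 1, ζ + s * η ∈ ball (0 : ℂ) 1 := fun η hη ↦ by
    rw [mem_ball_zero_iff] at hη ⊢
    calc ‖ζ + s * η‖ ≤ ‖ζ‖ + ‖(s : ℂ) * η‖ := norm_add_le _ _
      _ = ‖ζ‖ + s * ‖η‖ := by rw [norm_mul, Complex.norm_real, Real.norm_eq_abs, abs_of_pos hs0]
      _ < ‖ζ‖ + s * 1 := by gcongr
      _ ≤ 1 := by linarith
  have haff : ∀ η, HasDerivAt (fun η : ℂ ↦ ζ + s * η) (s : ℂ) η := fun η ↦ by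
    simpa using ((hasDerivAt_id η).const_mul (s : ℂ)).const_add ζ
  have hΦd : DifferentiableOn ℂ Φ (ball 0 1) :=
    hF.comp (fun η _ ↦ (haff η).differentiableAt.differentiableWithinAt) hA
  have hΦinj : InjOn Φ (ball 0 1) := fun η hη η' hη' h ↦ by
    have := hinj (hA η hη) (hA η' hη') h
    have hsc : (s : ℂ) ≠ 0 := by exact_mod_cast hs0.ne'
    simpa [hsc] using this
  -- `Φ'(0) = s F'(ζ)`
  have hFζ : HasDerivAt F (deriv F ζ) ζ :=
    (hF.differentiableAt (isOpen_ball.mem_nhds (mem_ball_zero_iff.2 hζ1))).hasDerivAt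
  have hΦ0 : deriv Φ 0 = s * deriv F ζ := by
    have h1 : HasDerivAt Φ (deriv F ζ * s) 0 := by
      have hF' : HasDerivAt F (deriv F ζ) ((fun η : ℂ ↦ ζ + s * η) 0) := by simpa using hFζ
      exact hF'.comp 0 (haff 0)
    rw [h1.deriv]; ring
  -- Koebe 1/4 for `Φ`
  have hK : ball (Φ 0) (‖deriv Φ 0‖ / 4) ⊆ Φ '' ball 0 1 := koebeQuarter_holds Φ hΦd hΦinj
  have hΦ00 : Φ 0 = F ζ := by simp [hΦ]
  -- the radius
  have hdist := AreaThm.distortion_le_norm_deriv hF hinj hζ1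
  have hF0 := le_norm_deriv_zero hF hinj hρ₀ hsub
  have hrad : s * ρ₀ * (1 - r) / 32 ≤ ‖deriv Φ 0‖ / 4 := by
    rw [hΦ0, norm_mul, Complex.norm_real, Real.norm_eq_abs, abs_of_pos hs0]
    have h2 : ρ₀ * ((1 - r) / 8) ≤ ‖deriv F ζ‖ := by
      refine le_trans ?_ hdist
      have h3 : (1 - r) / 8 ≤ (1 - ‖ζ‖) / (1 + ‖ζ‖) ^ 3 := by
        rw [div_le_div_iff₀ (by norm_num) (by positivity)]
        have h4 : (1 + ‖ζ‖) ^ 3 ≤ 2 ^ 3 :=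
          pow_le_pow_left₀ (by positivity) (by linarith) 3
        have h5 : 0 ≤ 1 - r := by linarith
        nlinarith [norm_nonneg ζ, mul_le_mul_of_nonneg_left h4 h5]
      exact mul_le_mul hF0 h3 (by linarith) (norm_nonneg _)
    calc s * ρ₀ * (1 - r) / 32 = s * (ρ₀ * ((1 - r) / 8)) / 4 := by ring
      _ ≤ s * ‖deriv F ζ‖ / 4 := by gcongr
  calc ball (F ζ) (s * ρ₀ * (1 - r) / 32) ⊆ ball (Φ 0) (‖deriv Φ 0‖ / 4) := by
        rw [hΦ00]; exact ball_subset_ball hrad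
    _ ⊆ Φ '' ball 0 1 := hK

/-- **Distance to the boundary of conformal-interior points** (LSW (2004), §5.1: "there is a
constant `c₁ = c₁(ε) > 0` such that `dist(w_j, ∂D) ≥ c₁ inrad(D)`"): if `B(F 0, ρ₀) ⊆ F(𝔻)` and
`|ζ| ≤ r < 1` then `B(F ζ, ρ₀ (1-r)²/32) ⊆ F(𝔻)` (`ball_subset_image_affine` with `s = 1 - r`).
[cite: LawlerSchrammWerner2004, §5.1 (proof of Lemma 5.2)] -/
theorem ball_subset_image_of_norm_le {ρ₀ : ℝ} (hρ₀ : 0 < ρ₀)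
    (hsub : ball (F 0) ρ₀ ⊆ F '' ball 0 1) {ζ : ℂ} {r : ℝ} (hζ : ‖ζ‖ ≤ r) (hr : r < 1) :
    ball (F ζ) (ρ₀ * (1 - r) ^ 2 / 32) ⊆ F '' ball 0 1 := by
  have h := ball_subset_image_affine hF hinj hρ₀ hsub hζ hr (s := 1 - r) (by linarith) le_rfl
  have himg : (fun η : ℂ ↦ F (ζ + (1 - r : ℝ) * η)) '' ball 0 1 ⊆ F '' ball 0 1 := by
    rintro _ ⟨η, hη, rfl⟩
    refine ⟨_, ?_, rfl⟩
    rw [mem_ball_zero_iff] at hη ⊢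
    have hr1 : 0 < 1 - r := by linarith
    calc ‖ζ + ((1 - r : ℝ) : ℂ) * η‖ ≤ ‖ζ‖ + ‖((1 - r : ℝ) : ℂ) * η‖ := norm_add_le _ _
      _ = ‖ζ‖ + (1 - r) * ‖η‖ := by
          rw [norm_mul, Complex.norm_real, Real.norm_eq_abs, abs_of_pos hr1]
      _ < ‖ζ‖ + (1 - r) * 1 := by gcongr
      _ ≤ r + (1 - r) * 1 := by linarith
      _ = 1 := by ring
  have heq : (1 - r) * ρ₀ * (1 - r) / 32 = ρ₀ * (1 - r) ^ 2 / 32 := by ring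
  rw [heq] at h
  exact h.trans himg

/-- **Conformal coordinates of nearby points are nearby** (LSW (2004), §5: "if `v_j` is the vertex
in `D` closest to `w_j`, then …"; "we may find a vertex `v ∈ V_{D'}` such that
`|ψ_{D'}(v) - z| < c₂/4`, assuming that `r₀` is large enough"): if `B(F 0, ρ₀) ⊆ F(𝔻)`,
`|ζ| ≤ r < 1`, `0 < ε ≤ 1 - r`, then every point `v` with `‖v - F ζ‖ < ε ρ₀ (1-r)/32` is `F ζ'`
for some `ζ'` with `‖ζ' - ζ‖ < ε`. [cite: LawlerSchrammWerner2004, §5.1 (proof of Lemma 5.2)] -/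
theorem exists_apply_eq_of_norm_sub_lt {ρ₀ : ℝ} (hρ₀ : 0 < ρ₀)
    (hsub : ball (F 0) ρ₀ ⊆ F '' ball 0 1) {ζ : ℂ} {r : ℝ} (hζ : ‖ζ‖ ≤ r) (hr : r < 1)
    {ε : ℝ} (hε : 0 < ε) (hε1 : ε ≤ 1 - r) {v : ℂ} (hv : ‖v - F ζ‖ < ε * ρ₀ * (1 - r) / 32) :
    ∃ ζ' : ℂ, ‖ζ' - ζ‖ < ε ∧ ‖ζ'‖ < 1 ∧ F ζ' = v := by
  have h := ball_subset_image_affine hF hinj hρ₀ hsub hζ hr hε hε1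
  obtain ⟨η, hη, hηv⟩ := h (mem_ball_iff_norm.2 hv)
  rw [mem_ball_zero_iff] at hη
  refine ⟨ζ + ε * η, ?_, ?_, hηv⟩
  · rw [add_sub_cancel_left, norm_mul, Complex.norm_real, Real.norm_eq_abs, abs_of_pos hε]
    calc ε * ‖η‖ < ε * 1 := by gcongr
      _ = ε := mul_one ε
  · calc ‖ζ + ε * η‖ ≤ ‖ζ‖ + ‖(ε : ℂ) * η‖ := norm_add_le _ _
      _ = ‖ζ‖ + ε * ‖η‖ := by rw [norm_mul, Complex.norm_real, Real.norm_eq_abs, abs_of_pos hε]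
      _ < r + ε * 1 := by
          refine add_lt_add_of_le_of_lt hζ ?_
          gcongr
      _ ≤ 1 := by linarith

/-- **Steps along the disc are short** (LSW (2004), §5.1: "if `ℓ = ℓ(ε)` is large then
`|w_j - w_{j-1}| ≤ c₁ inrad(D)/20`"): if `b ∉ F(𝔻)` with `‖b - F 0‖ ≤ ρ₁` then for
`|ζ|, |ζ'| ≤ r < 1`, `‖F ζ - F ζ'‖ ≤ 8 ρ₁ (1-r)⁻³ ‖ζ - ζ'‖` (distortion upper bound
`|F'| ≤ |F'(0)| (1+r)/(1-r)³ ≤ 4ρ₁ · 2/(1-r)³` on the disc of radius `r`, and the mean value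
inequality). [cite: LawlerSchrammWerner2004, §5.1 (proof of Lemma 5.2)] -/
theorem norm_sub_le_of_norm_le {ρ₁ : ℝ} {b : ℂ} (hb : b ∉ F '' ball 0 1) (hbρ : ‖b - F 0‖ ≤ ρ₁)
    {r : ℝ} (hr : r < 1) {ζ ζ' : ℂ} (hζ : ‖ζ‖ ≤ r) (hζ' : ‖ζ'‖ ≤ r) :
    ‖F ζ - F ζ'‖ ≤ 8 * ρ₁ / (1 - r) ^ 3 * ‖ζ - ζ'‖ := by
  have hF0 := norm_deriv_zero_le hF hinj hb hbρ
  have hρ₁ : 0 ≤ ρ₁ := (norm_nonneg _).trans hbρ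
  have hr0 : 0 ≤ r := (norm_nonneg _).trans hζ
  have hbound : ∀ z ∈ closedBall (0 : ℂ) r, ‖deriv F z‖ ≤ 8 * ρ₁ / (1 - r) ^ 3 := fun z hz ↦ by
    rw [mem_closedBall_zero_iff] at hz
    have hz1 : ‖z‖ < 1 := hz.trans_lt hr
    refine (AreaThm.norm_deriv_le_distortion hF hinj hz1).trans ?_
    have h1 : (1 + ‖z‖) / (1 - ‖z‖) ^ 3 ≤ 2 / (1 - r) ^ 3 := by
      have ha : 0 < 1 - r := by linarith
      have hb' : 0 < 1 - ‖z‖ := by linarith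
      rw [div_le_div_iff₀ (by positivity) (by positivity)]
      have h3 : (1 - r) ^ 3 ≤ (1 - ‖z‖) ^ 3 := by gcongr
      nlinarith [pow_pos ha 3, norm_nonneg z]
    calc ‖deriv F 0‖ * ((1 + ‖z‖) / (1 - ‖z‖) ^ 3) ≤ 4 * ρ₁ * (2 / (1 - r) ^ 3) :=
          mul_le_mul hF0 h1 (by positivity) (by positivity)
      _ = 8 * ρ₁ / (1 - r) ^ 3 := by ring
  have hdiff : ∀ z ∈ closedBall (0 : ℂ) r, DifferentiableAt ℂ F z := fun z hz ↦
    hF.differentiableAt (isOpen_ball.mem_nhds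
      (mem_ball_zero_iff.2 ((mem_closedBall_zero_iff.1 hz).trans_lt hr)))
  have h := (convex_closedBall (0 : ℂ) r).norm_image_sub_le_of_norm_deriv_le hdiff hbound
    (mem_closedBall_zero_iff.2 hζ') (mem_closedBall_zero_iff.2 hζ)
  exact h

/-- **Position of conformal-interior points**: `‖F ζ - F 0‖ ≤ 4 ρ₁ |ζ|/(1 - |ζ|)²` (growth theorem
and Koebe). [cite: PommerenkeBBCM1992, Thm. 1.3] -/
theorem norm_sub_apply_zero_le {ρ₁ : ℝ} {b : ℂ} (hb : b ∉ F '' ball 0 1) (hbρ : ‖b - F 0‖ ≤ ρ₁)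
    {ζ : ℂ} (hζ : ‖ζ‖ < 1) : ‖F ζ - F 0‖ ≤ 4 * ρ₁ * (‖ζ‖ / (1 - ‖ζ‖) ^ 2) :=
  (AreaThm.norm_sub_le_growth hF hinj hζ).trans
    (mul_le_mul_of_nonneg_right (norm_deriv_zero_le hF hinj hb hbρ) (by positivity))

/-- **The chain from the base point to a conformal-interior point** (LSW (2004), §5.1, the points
`w_j = ψ_D⁻¹(j ψ_D(v)/ℓ)`): for `|ζ| ≤ r < 1` and `N ≥ 1` the points `w_j = F((j/N) ζ)` satisfy
`w_0 = F 0`, `w_N = F ζ`, `B(w_j, ρ₀(1-r)²/32) ⊆ F(𝔻)` and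
`‖w_{j+1} - w_j‖ ≤ 8 ρ₁ r (1-r)⁻³ / N`. [cite: LawlerSchrammWerner2004, §5.1 (proof of Lemma 5.2)] -/
theorem chain {ρ₀ ρ₁ : ℝ} (hρ₀ : 0 < ρ₀) (hsub : ball (F 0) ρ₀ ⊆ F '' ball 0 1) {b : ℂ}
    (hb : b ∉ F '' ball 0 1) (hbρ : ‖b - F 0‖ ≤ ρ₁) {ζ : ℂ} {r : ℝ} (hζ : ‖ζ‖ ≤ r) (hr : r < 1)
    {N : ℕ} (hN : 0 < N) :
    (fun j : ℕ ↦ F ((j / N : ℝ) * ζ)) 0 = F 0 ∧ (fun j : ℕ ↦ F ((j / N : ℝ) * ζ)) N = F ζ ∧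
      (∀ j ≤ N, ball (F ((j / N : ℝ) * ζ)) (ρ₀ * (1 - r) ^ 2 / 32) ⊆ F '' ball 0 1) ∧
      ∀ j < N, ‖F (((j + 1 : ℕ) / N : ℝ) * ζ) - F ((j / N : ℝ) * ζ)‖ ≤
        8 * ρ₁ / (1 - r) ^ 3 * (r / N) := by
  have hN' : (0 : ℝ) < N := by exact_mod_cast hN
  have hr0 : 0 ≤ r := (norm_nonneg _).trans hζ
  have hnorm : ∀ j : ℕ, j ≤ N → ‖((j / N : ℝ) : ℂ) * ζ‖ ≤ r := fun j hj ↦ by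
    rw [norm_mul, Complex.norm_real, Real.norm_eq_abs, abs_of_nonneg (by positivity)]
    have : (j : ℝ) / N ≤ 1 := by rw [div_le_one hN']; exact_mod_cast hj
    calc (j : ℝ) / N * ‖ζ‖ ≤ 1 * r := mul_le_mul this hζ (norm_nonneg _) zero_le_one
      _ = r := one_mul r
  refine ⟨by simp, ?_, fun j hj ↦ ball_subset_image_of_norm_le hF hinj hρ₀ hsub (hnorm j hj) hr,
    fun j hj ↦ ?_⟩
  · show F (((N : ℕ) / N : ℝ) * ζ) = F ζ
    rw [div_self hN'.ne']; simp
  · refine (norm_sub_le_of_norm_le hF hinj hb hbρ hr (hnorm (j + 1) hj) (hnorm j hj.le)).trans ?_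
    have hρ₁ : 0 ≤ ρ₁ := (norm_nonneg _).trans hbρ
    have hstep : ‖(((j + 1 : ℕ) / N : ℝ) : ℂ) * ζ - ((j / N : ℝ) : ℂ) * ζ‖ ≤ r / N := by
      rw [← sub_mul, norm_mul, ← Complex.ofReal_sub, Complex.norm_real, Real.norm_eq_abs]
      have : ((j + 1 : ℕ) : ℝ) / N - j / N = 1 / N := by push_cast; ring
      rw [this, abs_of_pos (by positivity), one_div, inv_mul_eq_div]
      exact div_le_div_of_nonneg_right hζ hN'.le
    exact mul_le_mul_of_nonneg_left hstep (by positivity)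

end KoebeInterior

end Literature.Analysis.Complex
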